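import Summits.ABC.IUTFork.DAGL2s
import Summits.ABC.IUTFork.DAGL2t
import Summits.ABC.IUTFork.DAGXq

/-!
# Kernel DAG index — witness UPGRADE part v (GENERATED by abc-iut-c312-2 gen 7 `work/gen_index.py upgrade` @2026-08-27T02:07Z from HOME/plan/DAG.tsv
(regenerated 2026-08-27T02:06:10Z); spec v1.3 §2(c) "`_holds` iff the DAG row is discharged", §5 "re-file when nodes change status")

THIS FILE PROVES NOTHING NEW AND ASSERTS NOTHING. For 6 nodes ALREADY INDEXED with a partial witness `N_<id>_part` (their DAG row was
`landed(p…)` when indexed) whose row is NOW `discharged(p…)`, it adds the discharge witness `N_<id>_holds : N_<id> := N_<id>_part` BY NAME —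
the node statement `N_<id>` is untouched (append-only across files: nothing landed is redefined). Nothing here says abc is proved or refuted
or takes a side on [IUTchIII] Cor 3.12. typed ≠ discharged; indexed ≠ endorsed.
-/

namespace Summit.ABC.IUTFork.DAG

/-- [node EtTh:Thm4.4(i) · L2/D1 · DAG status discharged(p407737)] discharge witness of `N_EtTh_Thm4_4_i` (indexed in `DAGL2s` with `_part` while the row was landed; now discharged, p407737): BY NAME; proves nothing new. -/
theorem N_EtTh_Thm4_4_i_holds : N_EtTh_Thm4_4_i := N_EtTh_Thm4_4_i_part

/-- [node EtTh:Thm4.4(ii) · L2/D1 · DAG status discharged(p407737)] discharge witness of `N_EtTh_Thm4_4_ii` (indexed in `DAGL2s` with `_part` while the row was landed; now discharged, p407737): BY NAME; proves nothing new. -/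
theorem N_EtTh_Thm4_4_ii_holds : N_EtTh_Thm4_4_ii := N_EtTh_Thm4_4_ii_part

/-- [node EtTh:Thm4.4(iii) · L2/D1 · DAG status discharged(p407737)] discharge witness of `N_EtTh_Thm4_4_iii` (indexed in `DAGL2s` with `_part` while the row was landed; now discharged, p407737): BY NAME; proves nothing new. -/
theorem N_EtTh_Thm4_4_iii_holds : N_EtTh_Thm4_4_iii := N_EtTh_Thm4_4_iii_part

/-- [node EtTh:Prop5.1 · L2/D1 · DAG status discharged(p481101)] discharge witness of `N_EtTh_Prop5_1` (indexed in `DAGL2s` with `_part` while the row was landed; now discharged, p481101): BY NAME; proves nothing new. -/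
theorem N_EtTh_Prop5_1_holds : N_EtTh_Prop5_1 := N_EtTh_Prop5_1_part

/-- [node EtTh:Thm5.7 · L2/D1 · DAG status discharged(p484296+p484463)] discharge witness of `N_EtTh_Thm5_7` (indexed in `DAGL2t` with `_part` while the row was landed; now discharged, p484296): BY NAME; proves nothing new. -/
theorem N_EtTh_Thm5_7_holds : N_EtTh_Thm5_7 := N_EtTh_Thm5_7_part

/-- [node AbsTopIII:Cor5.5(iv) · L4/D1 · DAG status discharged(p478883)] discharge witness of `N_AbsTopIII_Cor5_5_iv'` (indexed in `DAGXq` with `_part` while the row was landed; now discharged, p478883): BY NAME; proves nothing new. -/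
theorem N_AbsTopIII_Cor5_5_iv'_holds : N_AbsTopIII_Cor5_5_iv' := N_AbsTopIII_Cor5_5_iv'_part

end Summit.ABC.IUTFork.DAG
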